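import Summits.RiemannHypothesis.RiemannHypothesis.Theorems.LiTailMidpointBridgeFresnel
import Summits.RiemannHypothesis.RiemannHypothesis.Theorems.LiTailMidpointDefs
import HarnessLib

/-!
# RiemannHypothesis / LiTailMidpoint — the PARTIAL LAGUERRE BRIDGE THROUGH THE FRESNEL TRANSITION, uniformly in the cut
# (RH-FREE, pure analysis; round-9 core of the LI column)

RH-FREE [rh-li-eng-4 g6].  Cell `pub/rh-li`.  Round 8 (`Theses/LiTailMidpoint.lean`, CLOSED on the item side) evaluates the
partial bridge `liBridgeTail n y T = ∫_T^∞ 2(1 − cos nθ(t)) cos(ty) dt` (PART M) only AT the stationary height `T ≈ t₀ = √(n/y − ¼)`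
(crux K2 `liBridgeHalves_proof`: it is HALF the complete bridge).  The round-9 target booked by theory g10 (TARGETS §15.5, eng-6 g4
exhibits 3–4: «uniform tail–Fresnel law with boundary term») needs the partial bridge for EVERY cut in a window around `t₀`,
i.e. through the whole Fresnel transition.  THIS FILE proves it:

* `liBridgeTail_uniform` — for `y > 0` there are `N`, `C` with, for all `n ≥ N` and EVERY `T ∈ [t₀/2, 2t₀]`,
  `|liBridgeTail n y T + Re{ e^{iF(t₀)} F''(t₀)^{−1/2} · [fresnelLim − σ(T)·fresnelS(√(2(F(T) − F(t₀))))] }| ≤ C log n`,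
  `σ(T) = +1` for `T ≥ t₀`, `−1` for `T < t₀` (`F = Fejer.phF n y`, `t₀ = Fejer.tz n y`, `fresnelS X = ∫_0^X e^{iu²/2} du`,
  `fresnelLim = ∫_0^∞`): the zeros-side main term is MINUS the real part of the incomplete Fresnel integral of the exact phase
  increment — `½`-release at `T = t₀` (`fresnelS 0 = 0`), full release for `T ≪ t₀` (`fresnelS → fresnelLim`, bracket `→ 2·fresnelLim
  = 𝔣`), silence for `T ≫ t₀` (bracket `→ 0`), with the Fresnel oscillations in between (eng-6 g4's variable `X = U/√π`).

Proof: `liBridgeTail n y T = ∫_0^L K − ∫_0^T K + ∫_{Ioi L} K` (`Fejer.bridge_split` twice, `L = max(2t₀, n²)`, far tail `≤ 1`);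
`∫_0^X K = 2 sin(Xy)/y − Re∫_0^X e^{iF} − Re∫_0^X e^{iG}` (`Fejer.bridge_trunc_eq`, `|∫ e^{iG}| ≤ 2/y`); `∫_T^L e^{iF} = ∫_{t₀}^L e^{iF} −
∫_{t₀}^T e^{iF}` with `∫_{t₀}^{L} e^{iF} = M·fresnelLim + O_y(log n)` (`BridgeFresnel.norm_integral_tz_Ioi_sub_le`) and
`∫_{t₀}^{T} e^{iF} = σ(T)·M·fresnelS(√(2(F(T) − F(t₀)))) + O_y(log n)` (`BridgeFresnel.norm_integral_tz_right_sub_le` /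
`norm_integral_tz_left_sub_le`, the UNIFORM stationary-phase lemma `Literature.Analysis.Fourier.stationaryPhase_uniform`).
Nothing here bears on the truth of RH: a statement about an explicit oscillatory integral; no data of record is added or changed.
-/

noncomputable section

-- D-0017: `Summit.<S>.<S>.…` is the designed namespace of a single-problem summit.
set_option linter.dupNamespace false

open Set MeasureTheory intervalIntegral Complex
open Literature.Analysis.Fourier

namespace Summit.RiemannHypothesis.RiemannHypothesis.Theorems.LiTheory

namespace BridgeUniform

open Fejer BridgeFresnel

/-- **The partial Laguerre bridge through the Fresnel transition** (RH-FREE; round-9 core): for `y > 0` there are `N`, `C` with,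
for all `n ≥ N` and every cut `T ∈ [t₀/2, 2t₀]` (`t₀ = tz n y`),
`|liBridgeTail n y T + Re{e^{iF(t₀)} F''(t₀)^{−1/2} [fresnelLim − σ(T) fresnelS(√(2(F(T) − F(t₀))))]}| ≤ C log n`,
`σ(T) = 1` if `t₀ ≤ T`, else `−1`. -/
theorem liBridgeTail_uniform (y : ℝ) (hy : 0 < y) :
    ∃ N : ℕ, ∃ C : ℝ, ∀ n : ℕ, N ≤ n → ∀ T : ℝ, tz n y / 2 ≤ T → T ≤ 2 * tz n y →
      |liBridgeTail n y T
          + (cexp (I * phF n y (tz n y)) * ((Real.sqrt (phF2 n (tz n y)))⁻¹ : ℝ)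
              * (fresnelLim - (if tz n y ≤ T then (1 : ℂ) else -1)
                  * fresnelS (Real.sqrt (2 * (phF n y T - phF n y (tz n y)))))).re|
        ≤ C * Real.log n := by
  set Ky : ℝ := 2 * 320 ^ 3 * 40000 / y with hKy
  have hKy0 : 0 ≤ Ky := by positivity
  set C0 : ℝ := 4 * Ky + 52 / y + 1 with hC0
  set C1 : ℝ := 4 * Ky with hC1
  have hl2 : 0 < Real.log 2 := Real.log_pos (by norm_num)
  refine ⟨⌈2 * y⌉₊ + 2, C0 / Real.log 2 + C1, fun n hn T hT1 hT2 ↦ ?_⟩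
  have hn2 : 2 ≤ n := by omega
  have hnr : (2 : ℝ) ≤ n := by exact_mod_cast hn2
  have hnc : (⌈2 * y⌉₊ : ℝ) + 2 ≤ n := by exact_mod_cast hn
  have h2y : 2 * y ≤ (n : ℝ) := (Nat.le_ceil _).trans (by linarith)
  have hs0 := tz_pos hy h2y
  set s := tz n y with hs
  have hT0 : 0 ≤ T := by linarith
  have hlogn : Real.log 2 ≤ Real.log n := Real.log_le_log (by norm_num) hnr
  have hlog0 : 0 ≤ Real.log n := hl2.le.trans hlogn
  -- the main term and the sign
  set M : ℂ := cexp (I * phF n y s) * ((Real.sqrt (phF2 n s))⁻¹ : ℝ) with hM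
  set σc : ℂ := (if s ≤ T then (1 : ℂ) else -1) with hσ
  set fS : ℂ := fresnelS (Real.sqrt (2 * (phF n y T - phF n y s))) with hfS
  have hEc : Continuous fun t : ℝ ↦ cexp (I * phF n y t) := by have := continuous_phF n y; fun_prop
  have hEi : ∀ a b : ℝ, IntervalIntegrable (fun t : ℝ ↦ cexp (I * phF n y t)) volume a b :=
    fun a b ↦ hEc.intervalIntegrable a b
  -- `L = max(2t₀, n²)`
  set L : ℝ := max (2 * s) ((n : ℝ) ^ 2) with hL
  have hL2s : 2 * s ≤ L := le_max_left _ _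
  have hLn : (n : ℝ) ^ 2 ≤ L := le_max_right _ _
  have hL0 : 0 < L := by positivity
  -- ### the exact identities (all real)
  have hsplitT : ∫ t in Ioi (0 : ℝ), 2 * (1 - Real.cos (n * liZeroAngle t)) * Real.cos (t * y)
      = (∫ t in (0 : ℝ)..T, 2 * (1 - Real.cos (n * liZeroAngle t)) * Real.cos (t * y)) + liBridgeTail n y T := by
    rw [liBridgeTail]; exact bridge_split n y hT0
  have hsplitL := bridge_split n y hL0.le
  have htruncL := bridge_trunc_eq n hy hL0.le
  have htruncT := bridge_trunc_eq n hy hT0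
  have hF0L : (∫ t in (0 : ℝ)..L, cexp (I * phF n y t)).re
      = (∫ t in (0 : ℝ)..s, cexp (I * phF n y t)).re + (∫ t in s..L, cexp (I * phF n y t)).re := by
    rw [← integral_add_adjacent_intervals (hEi 0 s) (hEi s L), Complex.add_re]
  have hF0T : (∫ t in (0 : ℝ)..T, cexp (I * phF n y t)).re
      = (∫ t in (0 : ℝ)..s, cexp (I * phF n y t)).re + (∫ t in s..T, cexp (I * phF n y t)).re := by
    rw [← integral_add_adjacent_intervals (hEi 0 s) (hEi s T), Complex.add_re]
  set e2 : ℂ := (∫ t in s..L, cexp (I * phF n y t)) - M * fresnelLim with he2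
  set eT : ℂ := (∫ t in s..T, cexp (I * phF n y t)) - σc * (M * fS) with heT
  have he2re : e2.re = (∫ t in s..L, cexp (I * phF n y t)).re - (M * fresnelLim).re := by
    rw [he2, Complex.sub_re]
  have heTre : eT.re = (∫ t in s..T, cexp (I * phF n y t)).re - (σc * (M * fS)).re := by
    rw [heT, Complex.sub_re]
  have hmain : (M * (fresnelLim - σc * fS)).re = (M * fresnelLim).re - (σc * (M * fS)).re := by
    have : M * (σc * fS) = σc * (M * fS) := by ring
    rw [mul_sub, Complex.sub_re, this]
  -- ### the bounds
  have hA2 : ‖e2‖ ≤ Ky * (2 + 2 * Real.log n) + 44 / y := norm_integral_tz_Ioi_sub_le hy h2y hn2 hL2s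
  have hAT : ‖eT‖ ≤ Ky * (2 + 2 * Real.log n) := by
    have hK0 : 0 ≤ 2 * (320 : ℝ) ^ 3 * 40000 / y := by positivity
    by_cases hsT : s ≤ T
    · have hσ1 : σc = 1 := by rw [hσ, if_pos hsT]
      have h := norm_integral_tz_right_sub_le hy h2y hsT hT2
      have hlog := log_bound hy h2y hn2 (d := T - s) (by linarith) (by linarith)
      rw [heT, hσ1, one_mul]
      refine h.trans (mul_le_mul_of_nonneg_left ?_ hK0)
      linarith
    · push Not at hsT
      have hσ1 : σc = -1 := by rw [hσ, if_neg (not_le.2 hsT)]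
      have h := norm_integral_tz_left_sub_le hy h2y hT1 hsT.le
      have hlog := log_bound hy h2y hn2 (d := s - T) (by linarith) (by linarith)
      have hsymm : (∫ t in s..T, cexp (I * phF n y t)) = -∫ t in T..s, cexp (I * phF n y t) :=
        intervalIntegral.integral_symm _ _
      rw [heT, hσ1, hsymm, show -(∫ t in T..s, cexp (I * ↑(phF n y t))) - -1 * (M * fS)
        = -((∫ t in T..s, cexp (I * ↑(phF n y t))) - M * fS) by ring, norm_neg]
      refine h.trans (mul_le_mul_of_nonneg_left ?_ hK0)
      linarith
  have hG_L := norm_G_piece n hy hL0.le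
  have hG_T := norm_G_piece n hy hT0
  have htail := abs_bridge_tail_le n y hL0
  have htail1 : (n : ℝ) ^ 2 / L ≤ 1 := by rw [div_le_one hL0]; exact hLn
  have hsin1 : |Real.sin (L * y)| ≤ 1 := Real.abs_sin_le_one _
  have hsin2 : |Real.sin (T * y)| ≤ 1 := Real.abs_sin_le_one _
  have r2 := Complex.abs_re_le_norm e2
  have rT := Complex.abs_re_le_norm eT
  have r4 := Complex.abs_re_le_norm (∫ t in (0 : ℝ)..L, cexp (I * phG n y t))
  have r5 := Complex.abs_re_le_norm (∫ t in (0 : ℝ)..T, cexp (I * phG n y t))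
  -- ### the main identity (linear bookkeeping)
  have hkey : liBridgeTail n y T + (M * (fresnelLim - σc * fS)).re
      = (2 * (Real.sin (L * y) / y) - 2 * (Real.sin (T * y) / y))
        - e2.re + eT.re
        - (∫ t in (0 : ℝ)..L, cexp (I * phG n y t)).re + (∫ t in (0 : ℝ)..T, cexp (I * phG n y t)).re
        + (∫ t in Ioi L, 2 * (1 - Real.cos (n * liZeroAngle t)) * Real.cos (t * y)) := by
    rw [hmain, he2re, heTre]
    linarith [hsplitT, hsplitL, htruncL, htruncT, hF0L, hF0T]
  rw [hkey]
  -- ### numerical assembly (all `c / y` as multiples of `w = 1/y`)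
  have hy1 : |Real.sin (L * y) / y| ≤ 1 / y := by
    rw [abs_div, abs_of_pos hy]; exact div_le_div_of_nonneg_right hsin1 hy.le
  have hy2 : |Real.sin (T * y) / y| ≤ 1 / y := by
    rw [abs_div, abs_of_pos hy]; exact div_le_div_of_nonneg_right hsin2 hy.le
  rw [abs_le] at hy1 hy2 r2 rT r4 r5 htail
  set P : ℝ := Ky * Real.log n with hP
  have eK : Ky * (2 + 2 * Real.log n) = 2 * Ky + 2 * P := by rw [hP]; ring
  have eC : 4 * Ky * Real.log n = 4 * P := by rw [hP]; ring
  have hA2' : ‖e2‖ ≤ 2 * Ky + 2 * P + 44 / y := by linarith [hA2, eK]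
  have hAT' : ‖eT‖ ≤ 2 * Ky + 2 * P := by linarith [hAT, eK]
  have hP0 : 0 ≤ P := mul_nonneg hKy0 hlog0
  set w : ℝ := 1 / y with hw
  have hw0 : 0 < w := by positivity
  have e2y : (2 : ℝ) / y = 2 * w := by rw [hw]; ring
  have e44 : (44 : ℝ) / y = 44 * w := by rw [hw]; ring
  have e52 : (52 : ℝ) / y = 52 * w := by rw [hw]; ring
  have hgoal : |2 * (Real.sin (L * y) / y) - 2 * (Real.sin (T * y) / y)
        - e2.re + eT.re
        - (∫ t in (0 : ℝ)..L, cexp (I * phG n y t)).re + (∫ t in (0 : ℝ)..T, cexp (I * phG n y t)).re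
        + (∫ t in Ioi L, 2 * (1 - Real.cos (n * liZeroAngle t)) * Real.cos (t * y))|
      ≤ C0 + C1 * Real.log n := by
    rw [abs_le, hC0, hC1, eC]
    constructor <;> linarith [hy1.1, hy1.2, hy2.1, hy2.2, r2.1, r2.2, rT.1, rT.2, r4.1, r4.2, r5.1, r5.2,
      htail.1, htail.2, hA2', hAT', hG_L, hG_T, htail1, hP0, hw0, hKy0, e2y, e44, e52]
  refine hgoal.trans ?_
  have hC00 : 0 ≤ C0 := by positivity
  have h1 : C0 ≤ C0 / Real.log 2 * Real.log n := by
    rw [div_mul_eq_mul_div, le_div_iff₀ hl2]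
    exact mul_le_mul_of_nonneg_left hlogn hC00
  have h2 : (C0 / Real.log 2 + C1) * Real.log n = C0 / Real.log 2 * Real.log n + C1 * Real.log n := by ring
  rw [h2]
  linarith

end BridgeUniform

end Summit.RiemannHypothesis.RiemannHypothesis.Theorems.LiTheory

end
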